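import Summits.AtomisticToContinuum.Crystallization.Theorems.OverbindingBudgetAffineFarCoreWindows
import Summits.AtomisticToContinuum.Crystallization.Theorems.OverbindingBudgetAffineLayerPoisson

/-!
# Overbinding budget, affine far-core cell (31280 Z2): registry insensitivity of the far-layer sums
# `layerSum B (2σ) k o` — the window-vocabulary consumer of the Poisson–Bessel leaf

(decomp-a2c lens-4, generation 65, leaf (IV) of memo NODE-g65 §8.)  Imports the g65 window file
(`layerVec`, `layerTerm`, `layerSum`) and the Poisson–Bessel leaf (`abs_tsum_int_pair_translate_sub_le`);
restates nothing.  PROVED, 0 sorry (certified inlined in probe `TowerG65b.lean`, rc 0; pins/axiom guards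
`TowerG65bPins.lean`; must-fail `TowerG65bMustFail.lean`):

* `layerShift B o k = o·Bw + k√(2/3)·Be₃`, `map_layerVec` (`B(layerVec i j o k) = i·Bt₁ + j·Bt₂ + layerShift`),
  `barlowOffset_one_eq` (`w = (t₁+t₂)/3`), `linearIndependent_triangularVec`, `linearIndependent_map_pair`
  (injective `B`), `layerShift_sub_mem` (two labels differ in-plane), `layerShift_not_mem` (`k ≠ 0` ⇒ the
  layer misses the origin), `layerTerm_two_mul`;
* ★ `abs_layerSum_sub_layerSum_le`: for injective `B`, `σ ≥ 2`, `k ≠ 0` and any labels `o, o'`,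
  `|layerSum B (2σ) k o − layerSum B (2σ) k o'| ≤ (4π/(Γ(σ)·covol Λ_B)) Σ_{w ∈ Λ_B^*} (π‖w‖/d_k)^{σ−1}
  K_{σ−1}(2π d_k ‖w‖)`, `Λ_B = ℤ·Bt₁ + ℤ·Bt₂ ⊂ W_B = span{Bt₁, Bt₂}`, `d_k = dist(layerShift B o k, W_B)`
  (`= |k|·dist(√(2/3)·Be₃, W_B)`, independent of `o`).  With `σ = 3` (`n = 6`) and `σ = 6` (`n = 12`)
  this bounds the coset spread `layerUp − layerLo` of every far layer of the window certificates by a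
  summable, exponentially small, explicitly computable Bessel sum (numbers: memo §8/§9 — `7.6·10⁻¹⁰` at
  `k = ±4`, `n = 6`, hcp cell).

The measurable structure on the plane `W_B` is a hypothesis (`[MeasurableSpace W_B] [BorelSpace W_B]`):
the consumer supplies `letI := borel W_B; haveI : BorelSpace W_B := ⟨rfl⟩`; `ZLattice.covolume` is then
w.r.t. the volume of the induced inner product space `W_B` (= the area `‖Bt₁ × Bt₂‖` of the deformed cell;
that identification and the numerical Bessel bounds are g66 work, memo §9).
-/

noncomputable section

open MeasureTheory Set Module
open scoped Real InnerProductSpace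

namespace Summit.AtomisticToContinuum.Crystallization.Theorems.OverbindingBudgetAffineFarSmoothSplit
open Literature.MathematicalPhysics.StatisticalMechanics Literature.Algebra.EuclideanLattices
  Literature.Analysis.FunctionSpaces
local notation "E3" => EuclideanSpace ℝ (Fin 3)

/-- The registry-and-height translate `o·Bw + k√(2/3)·Be₃` of layer `k` with label `o` under the linear cell map `B`. -/
noncomputable def layerShift (B : E3 →ₗ[ℝ] E3) (o k : ℤ) : E3 :=
  (o : ℝ) • B (barlowOffset 1) + (k : ℝ) • B (layerNormal (Real.sqrt (2 / 3)))

/-- `B(layerVec i j o k) = i·Bt₁ + j·Bt₂ + layerShift B o k`. [this file] -/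
theorem map_layerVec (B : E3 →ₗ[ℝ] E3) (i j o k : ℤ) :
    B (layerVec i j o k) =
      (i : ℝ) • B (triangularVec₁ 1) + (j : ℝ) • B (triangularVec₂ 1) + layerShift B o k := by
  -- (landing lane: `layerVec` is now an `abbrev` of the Literature `layerVec 1 √(2/3) o k i j`, review of p850035 — unfold both)
  simp only [layerVec, Literature.MathematicalPhysics.StatisticalMechanics.layerVec, layerShift, map_add, map_smul]
  abel

/-- `w = (t₁ + t₂)/3`. [folklore] -/
theorem barlowOffset_one_eq :
    barlowOffset (1 : ℝ) = (1 / 3 : ℝ) • (triangularVec₁ 1 + triangularVec₂ 1) := by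
  ext i
  fin_cases i <;> simp [barlowOffset, triangularVec₁, triangularVec₂] <;> ring

/-- `t₁, t₂` are linearly independent. [folklore] -/
theorem linearIndependent_triangularVec :
    LinearIndependent ℝ ![triangularVec₁ (1 : ℝ), triangularVec₂ 1] := by
  refine LinearIndependent.pair_iff.2 fun s t h => ?_
  have e0 : (s • triangularVec₁ (1 : ℝ) + t • triangularVec₂ 1) 0 = s + t / 2 := by
    simp [triangularVec₁, triangularVec₂]
    try ring
  have e1 : (s • triangularVec₁ (1 : ℝ) + t • triangularVec₂ 1) 1 = t * (Real.sqrt 3 / 2) := by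
    simp [triangularVec₁, triangularVec₂]
    try ring
  have z0 : (0 : E3) 0 = 0 := rfl
  have z1 : (0 : E3) 1 = 0 := rfl
  rw [h, z0] at e0
  rw [h, z1] at e1
  have hs3 : Real.sqrt 3 / 2 ≠ 0 := by positivity
  have ht : t = 0 := by
    rcases mul_eq_zero.1 e1.symm with h' | h'
    · exact h'
    · exact absurd h' hs3
  subst ht
  constructor
  · linarith
  · rfl

/-- `Bt₁, Bt₂` are linearly independent for injective `B`. [this file] -/
theorem linearIndependent_map_pair (B : E3 →ₗ[ℝ] E3) (hB : Function.Injective B) :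
    LinearIndependent ℝ ![B (triangularVec₁ 1), B (triangularVec₂ 1)] := by
  have h := linearIndependent_triangularVec.map' B (LinearMap.ker_eq_bot.2 hB)
  have hfun : (⇑B ∘ ![triangularVec₁ (1 : ℝ), triangularVec₂ 1]) =
      ![B (triangularVec₁ 1), B (triangularVec₂ 1)] := by
    funext i
    fin_cases i <;> rfl
  rw [hfun] at h
  exact h

/-- Two registries of the same layer differ by an in-plane vector. [this file] -/
theorem layerShift_sub_mem (B : E3 →ₗ[ℝ] E3) (o o' k : ℤ) :
    layerShift B o k - layerShift B o' k ∈
      Submodule.span ℝ (Set.range ![B (triangularVec₁ 1), B (triangularVec₂ 1)]) := by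
  have h : layerShift B o k - layerShift B o' k =
      (((o : ℝ) - o') / 3) • (B (triangularVec₁ 1) + B (triangularVec₂ 1)) := by
    rw [layerShift, layerShift, barlowOffset_one_eq, map_smul, map_add]
    module
  rw [h]
  exact Submodule.smul_mem _ _
    (add_mem (Submodule.subset_span ⟨0, rfl⟩) (Submodule.subset_span ⟨1, rfl⟩))

/-- A far layer (`k ≠ 0`) does not pass through the origin: its translate is not in the plane. [this file] -/
theorem layerShift_not_mem (B : E3 →ₗ[ℝ] E3) (hB : Function.Injective B) {k : ℤ} (hk : k ≠ 0)
    (o : ℤ) :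
    layerShift B o k ∉ Submodule.span ℝ (Set.range ![B (triangularVec₁ 1), B (triangularVec₂ 1)]) := by
  intro hmem
  have hrange : Set.range ![B (triangularVec₁ 1), B (triangularVec₂ 1)] =
      B '' Set.range ![triangularVec₁ (1 : ℝ), triangularVec₂ 1] := by
    rw [← Set.range_comp]
    congr 1
    funext i
    fin_cases i <;> rfl
  rw [hrange, Submodule.span_image] at hmem
  obtain ⟨y, hy, hyB⟩ := Submodule.mem_map.1 hmem
  have hq : y = (o : ℝ) • barlowOffset 1 + (k : ℝ) • layerNormal (Real.sqrt (2 / 3)) :=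
    hB (by rw [hyB, layerShift, map_add, map_smul, map_smul])
  have hzero : ∀ z ∈ Submodule.span ℝ (Set.range ![triangularVec₁ (1 : ℝ), triangularVec₂ 1]),
      (z : E3) 2 = 0 := by
    intro z hz
    induction hz using Submodule.span_induction with
    | mem x hx =>
        obtain ⟨i, rfl⟩ := hx
        fin_cases i <;> simp [triangularVec₁, triangularVec₂]
    | zero => rfl
    | add x y _ _ hx hy => simp [hx, hy]
    | smul r x _ hx => simp [hx]
  have h2 := hzero y hy
  rw [hq] at h2
  have h3 : ((o : ℝ) • barlowOffset (1 : ℝ) + (k : ℝ) • layerNormal (Real.sqrt (2 / 3))) 2 =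
      k * Real.sqrt (2 / 3) := by
    simp [barlowOffset, layerNormal]
    try ring
  rw [h3] at h2
  have hs : Real.sqrt (2 / 3) ≠ 0 := by positivity
  have hk0 : (k : ℝ) = 0 := by
    rcases mul_eq_zero.1 h2 with h' | h'
    · exact h'
    · exact absurd h' hs
  exact hk (by exact_mod_cast hk0)

/-- The even-power layer term as an inverse power of a squared norm. [this file] -/
theorem layerTerm_two_mul (B : E3 →ₗ[ℝ] E3) (σ : ℕ) (k o : ℤ) (ij : ℤ × ℤ) :
    layerTerm B (2 * σ) k o ij =
      ((‖(ij.1 : ℝ) • B (triangularVec₁ 1) + (ij.2 : ℝ) • B (triangularVec₂ 1) + layerShift B o k‖ ^ 2)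
        ^ σ)⁻¹ := by
  rw [layerTerm, map_layerVec, inv_pow, pow_mul]

/-- ★ **Registry insensitivity of the far-layer sums** `layerSum B (2σ) k o` (`σ ≥ 2`, `k ≠ 0`,
`B` injective): for any two labels `o, o'`,
`|layerSum B (2σ) k o − layerSum B (2σ) k o'| ≤ (4π/(Γ(σ)·covol Λ_B)) Σ_{w ∈ Λ_B^*} (π‖w‖/d)^{σ−1}
K_{σ−1}(2π d‖w‖)` with `Λ_B = ℤ·Bt₁ + ℤ·Bt₂` (in its plane `W_B`), `d = dist(layerShift B o k, W_B)
= |k|·dist(√(2/3)·Be₃, W_B)`.  This is leaf (IV) of memo NODE-g65 §8 in the window vocabulary: the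
coset spread of a far layer is a (summable, exponentially small) Bessel sum. [this file] -/
theorem abs_layerSum_sub_layerSum_le (B : E3 →ₗ[ℝ] E3) (hB : Function.Injective B)
    [MeasurableSpace (Submodule.span ℝ (Set.range ![B (triangularVec₁ 1), B (triangularVec₂ 1)]))]
    [BorelSpace (Submodule.span ℝ (Set.range ![B (triangularVec₁ 1), B (triangularVec₂ 1)]))]
    (σ : ℕ) (hσ : 1 < σ) {k : ℤ} (hk : k ≠ 0) (o o' : ℤ) :
    |layerSum B (2 * σ) k o - layerSum B (2 * σ) k o'| ≤
      4 * Real.sqrt π ^ 2 /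
          (Real.Gamma σ * ZLattice.covolume
            (Submodule.span ℤ (Set.range (Basis.span (linearIndependent_map_pair B hB))))) *
        ∑' w : dualLattice (Submodule.span ℤ (Set.range (Basis.span (linearIndependent_map_pair B hB)))),
          (π * ‖(w : Submodule.span ℝ (Set.range ![B (triangularVec₁ 1), B (triangularVec₂ 1)]))‖ /
              ‖layerShift B o k - (Submodule.span ℝ
                (Set.range ![B (triangularVec₁ 1), B (triangularVec₂ 1)])).starProjection
                  (layerShift B o k)‖) ^ ((σ : ℝ) - 1) *
            besselKReal ((σ : ℝ) - 1)
              (2 * π * ‖layerShift B o k - (Submodule.span ℝ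
                (Set.range ![B (triangularVec₁ 1), B (triangularVec₂ 1)])).starProjection
                  (layerShift B o k)‖ *
                ‖(w : Submodule.span ℝ (Set.range ![B (triangularVec₁ 1), B (triangularVec₂ 1)]))‖) := by
  simp only [layerSum, layerTerm_two_mul]
  exact abs_tsum_int_pair_translate_sub_le (linearIndependent_map_pair B hB) σ hσ
    (layerShift_sub_mem B o o' k) (layerShift_not_mem B hB hk o)

end Summit.AtomisticToContinuum.Crystallization.Theorems.OverbindingBudgetAffineFarSmoothSplit
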